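import Summits.ValiantsHypothesis.ValiantsHypothesis.Theorems.PencilTransfer.Negative.PencilTransferFalseWithoutIsVPFamily
import Literature.Computability.AlgebraicComplexity.ArithCircuitProofs

/-!
# `LacunarySymmetroid.PencilTransfer`: size tightness, and three refuted strengthenings

Negative lemmas for the crux `PencilTransfer` (item stmt-ValiantsHypothesis-18051, route
`LacunarySymmetroid`), filed by the crux-disprover seat. All witnesses are the genuine `VP` family
`Π_n = ∏_{j < N(n)} (x₀ - j)` (one variable, `N` p-bounded: degree `N(n)`, complexity `≤ 2N(n)` over `ℂ`),
restricted along `x₀ = X¹` (`N(n)` distinct real zeros `0, 1, …, N(n)-1`).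

* `pencilTransfer_size_ge` (TIGHTNESS in the two-term sector): every admissible pencil `(m, S)` for
  `(Π_n, d = 1)` has `m ≥ N(n)` — the size in the crux can never be below the real-zero count when
  `K = v(n) + 1 = 2` (`deg det (X • S₁ + S₀) ≤ m`), so the quasi-polynomial size bound is USED at full
  strength `m ≥ #zeros` along this family; in particular:
* `not_pencilTransfer_constSize`: the strengthening "size bounded by a constant `c = c(f, d)` independent
  of `n`" is false (`N = id`, level `n = c + 1`);
* `not_pencilTransfer_uniform`: the strengthening "one constant `c` for ALL `VP` families" (`∃ c ∀ f`
  instead of `∀ f ∃ c`) is false — at level `n = 0` the bound is `2^(c^c)` and the constant family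
  `N ≡ 2^(c^c) + 1` beats it (small-`n` slack only: the eventual version `∃ c ∀ f ∃ n₀ ∀ n ≥ n₀` holds
  with `c = 3`, since `dc ≤ 2^{17A²(log₂ n+1)²}`);
* `not_pencilTransfer_noConstTerm`: the constant-term slot `Fin.cons 0 (d n)` is load-bearing — with
  `K = v(n)` terms of exponents `d n` only, `det (X^{d} • S) = X^{dm} det S` vanishes at most at `0`,
  while `Π_2 = x₀(x₀ - 1)` vanishes at `1`.
-/

-- `Summit.ValiantsHypothesis.ValiantsHypothesis.…` is the tree's mandated single-conjunct layout
-- (Sub = Summit), so the duplicated namespace component is intended.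
set_option linter.dupNamespace false

namespace Summit.ValiantsHypothesis.ValiantsHypothesis.Theorems.PencilTransfer.Negative

open Polynomial Literature.Computability.AlgebraicComplexity
open Summit.ValiantsHypothesis.Theorems.PencilTransfer.Negative

/-! ### The witness family `∏_{j<N} (x₀ - j)` is a `VP` family -/

/-- Complexification of the product family: `(∏_{j<N} (x₀ - j)) ⊗ ℂ = ∏_{j<N} (x₀ - j)` over `ℂ`. [folklore] -/
theorem map_prod_X_sub_natCast (N : ℕ) :
    MvPolynomial.map (algebraMap ℝ ℂ)
        (∏ j ∈ Finset.range N, (MvPolynomial.X 0 - MvPolynomial.C (j : ℝ)) : MvPolynomial (Fin 1) ℝ) =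
      ∏ j ∈ Finset.range N, (MvPolynomial.X 0 - MvPolynomial.C (j : ℂ)) := by
  simp [map_prod, MvPolynomial.map_X]

/-- An affine form `x₀ - c` costs at most one gate: `L(x₀ - c) ≤ 1` (`x₀ - c = x₀ + (-c)`, variables and
constants are free). [cite: Burgisser2000, Def. 2.1] -/
theorem complexity_X_sub_C_le {k : Type*} [CommRing k] (c : k) :
    complexity (MvPolynomial.X (0 : Fin 1) - MvPolynomial.C c : MvPolynomial (Fin 1) k) ≤ 1 := by
  have h := complexity_add_le_holds (k := k) (σ := Fin 1) (MvPolynomial.X 0) (MvPolynomial.C (-c))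
  rw [complexity_X_holds, complexity_C_holds, MvPolynomial.C_neg, ← sub_eq_add_neg] at h
  simpa using h

/-- `L(∏_{j<N} (x₀ - j)) ≤ 2N` over any commutative ring (one subtraction and one multiplication per
factor). [cite: Burgisser2000, §2.1] -/
theorem complexity_prod_X_sub_natCast_le {k : Type*} [CommRing k] (N : ℕ) :
    complexity (∏ j ∈ Finset.range N, (MvPolynomial.X 0 - MvPolynomial.C (j : k)) :
      MvPolynomial (Fin 1) k) ≤ 2 * N := by
  induction N with
  | zero =>
    rw [Finset.range_zero, Finset.prod_empty, ← MvPolynomial.C_1, complexity_C_holds]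
  | succ N ih =>
    rw [Finset.prod_range_succ]
    calc _ ≤ complexity (∏ j ∈ Finset.range N, (MvPolynomial.X 0 - MvPolynomial.C (j : k)) :
              MvPolynomial (Fin 1) k) +
            complexity (MvPolynomial.X (0 : Fin 1) - MvPolynomial.C ((N : ℕ) : k)) + 1 :=
          complexity_mul_le_holds _ _
      _ ≤ 2 * N + 1 + 1 := by
          have h1 := complexity_X_sub_C_le (k := k) ((N : ℕ) : k)
          omega
      _ = 2 * (N + 1) := by ring

/-- `deg ∏_{j<N} (x₀ - j) ≤ N`. [folklore] -/
theorem totalDegree_prod_X_sub_natCast_le {k : Type*} [CommRing k] [Nontrivial k] (N : ℕ) :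
    (∏ j ∈ Finset.range N, (MvPolynomial.X 0 - MvPolynomial.C (j : k)) :
      MvPolynomial (Fin 1) k).totalDegree ≤ N := by
  have h1 : ∀ j : ℕ, (MvPolynomial.X (0 : Fin 1) - MvPolynomial.C (j : k) :
      MvPolynomial (Fin 1) k).totalDegree ≤ 1 := fun j =>
    (MvPolynomial.totalDegree_sub _ _).trans
      (max_le (MvPolynomial.totalDegree_X (R := k) (0 : Fin 1)).le
        (by rw [MvPolynomial.totalDegree_C]; exact Nat.zero_le 1))
  calc (∏ j ∈ Finset.range N, (MvPolynomial.X 0 - MvPolynomial.C (j : k)) :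
        MvPolynomial (Fin 1) k).totalDegree
      ≤ ∑ j ∈ Finset.range N, (MvPolynomial.X (0 : Fin 1) - MvPolynomial.C (j : k) :
          MvPolynomial (Fin 1) k).totalDegree := MvPolynomial.totalDegree_finsetProd _ _
    _ ≤ ∑ _j ∈ Finset.range N, 1 := Finset.sum_le_sum fun j _ => h1 j
    _ = N := by simp

/-- **The product family is `VP`**: for p-bounded `N`, the complexification of
`Π_n = ∏_{j<N(n)} (x₀ - j)` is a `VP` family (one variable, degree `≤ N(n)`, complexity `≤ 2N(n)`).
[cite: Burgisser2000, Def. 2.4] -/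
theorem isVPFamily_prod_X_sub_natCast {N : ℕ → ℕ} (hN : IsPBounded N) :
    IsVPFamily (fun n => MvPolynomial.map (algebraMap ℝ ℂ)
      (∏ j ∈ Finset.range (N n), (MvPolynomial.X 0 - MvPolynomial.C (j : ℝ)) :
        MvPolynomial (Fin 1) ℝ)) := by
  refine ⟨⟨⟨1, fun n => by simp⟩, hN.mono fun n => ?_⟩, ?_⟩
  · dsimp only
    rw [map_prod_X_sub_natCast]
    exact totalDegree_prod_X_sub_natCast_le (k := ℂ) (N n)
  · refine (IsPBounded.mul_holds (IsPBounded.const 2) hN).mono fun n => ?_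
    dsimp only
    rw [map_prod_X_sub_natCast]
    exact complexity_prod_X_sub_natCast_le (k := ℂ) (N n)

/-! ### Tightness of the size in the two-term sector -/

/-- **Size tightness (`K = 2`)**: if a two-term pencil `S₀ + X • S₁` of size `m` has the same real zero
set as `∏_{j<N} (x₀ - j)` along `x₀ = X`, then `N ≤ m` (`deg det ≤ m` versus `N` distinct zeros). So in
`PencilTransfer` the size `m` is at least the real-zero count of the restriction for this `VP` family:
the conclusion `m ≤ 2^((log₂ n + c)^c)` cannot be traded for anything below `#zeros`. [folklore] -/
theorem pencilTransfer_size_ge (N m : ℕ) (S : Fin (1 + 1) → Matrix (Fin m) (Fin m) ℝ)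
    (h : (Matrix.det (∑ l, ((X : ℝ[X]) ^ (Fin.cons (α := fun _ => ℕ) (0 : ℕ) (fun _ : Fin 1 => 1) l)) •
        (S l).map C)).roots.toFinset =
      (MvPolynomial.aeval (fun _ : Fin 1 => (X : ℝ[X]) ^ 1)
        (∏ j ∈ Finset.range N, (MvPolynomial.X 0 - MvPolynomial.C (j : ℝ)))).roots.toFinset) :
    N ≤ m := by
  have hR := card_roots_toFinset_prod_X_sub_natCast N
  rw [← h] at hR
  exact hR ▸ card_roots_toFinset_twoTermPencil_le m S

/-- **No constant size**: the strengthening of `PencilTransfer` in which the pencil size is bounded by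
a constant `c = c(f, d)` independent of `n` is false — for `Π_n = ∏_{j<n} (x₀ - j)` (a `VP` family),
level `n = c + 1` needs `m ≥ c + 1` (`pencilTransfer_size_ge`). [folklore] -/
theorem not_pencilTransfer_constSize :
    ¬ (∀ (v : ℕ → ℕ) (f : ∀ n, MvPolynomial (Fin (v n)) ℝ),
        IsVPFamily (fun n => MvPolynomial.map (algebraMap ℝ ℂ) (f n)) →
        ∀ d : (n : ℕ) → Fin (v n) → ℕ, ∃ c : ℕ, ∀ n : ℕ, ∃ m : ℕ, m ≤ c ∧
          ∃ S : Fin (v n + 1) → Matrix (Fin m) (Fin m) ℝ, (∀ l, (S l).IsSymm) ∧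
            (Matrix.det (∑ l, ((Polynomial.X : Polynomial ℝ) ^
                (Fin.cons (α := fun _ => ℕ) (0 : ℕ) (d n) l)) • (S l).map Polynomial.C)).roots.toFinset =
            (MvPolynomial.aeval (fun i => (Polynomial.X : Polynomial ℝ) ^ d n i) (f n)).roots.toFinset) := by
  intro h
  obtain ⟨c, hc⟩ := h (fun _ => 1)
    (fun n => ∏ j ∈ Finset.range n, (MvPolynomial.X 0 - MvPolynomial.C (j : ℝ)))
    (isVPFamily_prod_X_sub_natCast IsPBounded.id) (fun _ _ => 1)
  obtain ⟨m, hm, S, -, hroots⟩ := hc (c + 1)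
  have := pencilTransfer_size_ge (c + 1) m S hroots
  omega

/-- **No uniform constant**: the strengthening of `PencilTransfer` with ONE constant `c` for all `VP`
families (`∃ c ∀ v f d n` instead of `∀ v f d ∃ c ∀ n`) is false — at level `n = 0` the size bound is
`2^((log₂ 0 + c)^c) = 2^(c^c)`, and the constant `VP` family `∏_{j < 2^(c^c)+1} (x₀ - j)` needs
`m ≥ 2^(c^c) + 1`. (Small-`n` slack only; eventually in `n` a uniform `c = 3` does work.) [folklore] -/
theorem not_pencilTransfer_uniform :
    ¬ (∃ c : ℕ, ∀ (v : ℕ → ℕ) (f : ∀ n, MvPolynomial (Fin (v n)) ℝ),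
        IsVPFamily (fun n => MvPolynomial.map (algebraMap ℝ ℂ) (f n)) →
        ∀ (d : (n : ℕ) → Fin (v n) → ℕ) (n : ℕ), ∃ m : ℕ, m ≤ 2 ^ ((Nat.log 2 n + c) ^ c) ∧
          ∃ S : Fin (v n + 1) → Matrix (Fin m) (Fin m) ℝ, (∀ l, (S l).IsSymm) ∧
            (Matrix.det (∑ l, ((Polynomial.X : Polynomial ℝ) ^
                (Fin.cons (α := fun _ => ℕ) (0 : ℕ) (d n) l)) • (S l).map Polynomial.C)).roots.toFinset =
            (MvPolynomial.aeval (fun i => (Polynomial.X : Polynomial ℝ) ^ d n i) (f n)).roots.toFinset) := by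
  rintro ⟨c, hc⟩
  obtain ⟨m, hm, S, -, hroots⟩ := hc (fun _ => 1)
    (fun _ => ∏ j ∈ Finset.range (2 ^ (c ^ c) + 1), (MvPolynomial.X 0 - MvPolynomial.C (j : ℝ)))
    (isVPFamily_prod_X_sub_natCast (IsPBounded.const _)) (fun _ _ => 1) 0
  have h1 := pencilTransfer_size_ge (2 ^ (c ^ c) + 1) m S hroots
  rw [Nat.log_zero_right, zero_add] at hm
  omega

/-! ### The constant-term slot is load-bearing -/

/-- A one-term pencil `X^e • S` has determinant `X^{e m} · det S` (as a constant polynomial factor). [folklore] -/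
theorem det_X_pow_smul_map_C (m e : ℕ) (M : Matrix (Fin m) (Fin m) ℝ) :
    Matrix.det (((X : ℝ[X]) ^ e) • M.map C) = (X : ℝ[X]) ^ (e * m) * C (Matrix.det M) := by
  rw [Matrix.det_smul, Fintype.card_fin, ← pow_mul, RingHom.map_det, RingHom.mapMatrix_apply]

/-- `1` is never a root of a one-term pencil determinant `det (X^e • S)`: either the determinant is the
zero polynomial (no roots by convention) or its value at `1` is `det S ≠ 0`. [folklore] -/
theorem one_not_mem_roots_det_X_pow_smul (m e : ℕ) (M : Matrix (Fin m) (Fin m) ℝ) :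
    (1 : ℝ) ∉ (Matrix.det (((X : ℝ[X]) ^ e) • M.map C)).roots.toFinset := by
  rw [det_X_pow_smul_map_C, Multiset.mem_toFinset, Polynomial.mem_roots', Polynomial.IsRoot.def]
  rintro ⟨hne, heval⟩
  simp only [eval_mul, eval_pow, eval_X, one_pow, one_mul, eval_C] at heval
  exact hne (by rw [heval, map_zero, mul_zero])

/-- `1` is a root of `∏_{j<N} (x₀ - j)` along `x₀ = X` as soon as `N ≥ 2`. [folklore] -/
theorem one_mem_roots_aeval_prod (N : ℕ) (hN : 2 ≤ N) :
    (1 : ℝ) ∈ (MvPolynomial.aeval (fun _ : Fin 1 => (X : ℝ[X]) ^ 1)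
        (∏ j ∈ Finset.range N, (MvPolynomial.X 0 - MvPolynomial.C (j : ℝ)))).roots.toFinset := by
  rw [aeval_prod_X_sub_natCast, Polynomial.roots_prod_X_sub_C, Finset.val_toFinset, Finset.mem_image]
  exact ⟨1, Finset.mem_range.2 (by omega), Nat.cast_one⟩

/-- **The constant-term slot `Fin.cons 0 (d n)` is load-bearing**: the variant of `PencilTransfer` with
`K = v(n)` lacunary terms of exponents `d n` only (no `X^0` term) is false — for the `VP` family
`Π_n = ∏_{j<n} (x₀ - j)` with `d = 1`, at level `n = 2` the restriction `X(X - 1)` vanishes at `1`,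
while a one-term pencil determinant `det (X • S) = X^m det S` does not. [folklore] -/
theorem not_pencilTransfer_noConstTerm :
    ¬ (∀ (v : ℕ → ℕ) (f : ∀ n, MvPolynomial (Fin (v n)) ℝ),
        IsVPFamily (fun n => MvPolynomial.map (algebraMap ℝ ℂ) (f n)) →
        ∀ d : (n : ℕ) → Fin (v n) → ℕ, ∃ c : ℕ, ∀ n : ℕ, ∃ m : ℕ, m ≤ 2 ^ ((Nat.log 2 n + c) ^ c) ∧
          ∃ S : Fin (v n) → Matrix (Fin m) (Fin m) ℝ, (∀ l, (S l).IsSymm) ∧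
            (Matrix.det (∑ l, ((Polynomial.X : Polynomial ℝ) ^ (d n l)) • (S l).map Polynomial.C)).roots.toFinset =
            (MvPolynomial.aeval (fun i => (Polynomial.X : Polynomial ℝ) ^ d n i) (f n)).roots.toFinset) := by
  intro h
  obtain ⟨c, hc⟩ := h (fun _ => 1)
    (fun n => ∏ j ∈ Finset.range n, (MvPolynomial.X 0 - MvPolynomial.C (j : ℝ)))
    (isVPFamily_prod_X_sub_natCast IsPBounded.id) (fun _ _ => 1)
  obtain ⟨m, -, S, -, hroots⟩ := hc 2
  have h1 := one_mem_roots_aeval_prod 2 le_rfl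
  rw [← hroots, Fin.sum_univ_one] at h1
  exact one_not_mem_roots_det_X_pow_smul m 1 (S 0) h1

end Summit.ValiantsHypothesis.ValiantsHypothesis.Theorems.PencilTransfer.Negative
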